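/-
Copyright: the b2b-balaban cell (near-miss cell 7), T⁴-continuum CRUX team (coordinator ruling e34b3e0c item (2)),
seat t4-ne7b-formalise-leaf-06 (gen 26). Released under the licence of the surrounding project.
-/
import Summits.QuantumFields.BalabanUV.T4Continuum.Spine.NE7b.LocalPlaquetteExpMoments
-- v1.1 (APPEND-ONLY): the all-`β` corollary of the mean plaquette energy bound needs the sibling `…All` (p249347)
import Summits.QuantumFields.BalabanUV.T4Continuum.Spine.NE7b.LocalPlaquetteExpMomentsAll
import HarnessLib

/-!
# Local exponential plaquette moments with a SITE-DEPENDENT tilt profile — the multiplicative form of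
# (LS) at scale `j = 0` (route NE7b R-T1 of `t4/ROUTES-NE7b.md`, prediction P1-a, profile version)

Cell `pub-balaban`, sub-cell `t4`, spine estimate NE7b (node U5c), candidate route R-T1 «Markov–Chebyshev
chain bound» of `t4/ROUTES-NE7b.md` v1 (seat `t4-ne7b-idea-1`). The route's input (LS) is MULTI-LOCAL and
MULTIPLICATIVE: for window-separated blocks `□_i` with their own tilt parameters `a_i`,
`E[∏_i exp(a_i X_i)] ≤ exp(C ∑_i a_i |□_i|)`. At scale `j = 0` (the bare Wilson measure) this is the
statement below with a tilt PROFILE `a : sites → [0, ½]` (take `a = ∑_i a_i 1_{□_i}`):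

* `localExpMoment_profile` — for a faithful continuous unitary lattice representation `r` of a compact
  group `G` there is `C ≥ 0` with
  `∫ exp(β ∑ₓ a(x) (N − Re tr r(U_{(x,o)}))) dμ_β ≤ exp(C ∑ₓ a(x))`
  for every odd torus `(ℤ/(2S+1))⁴` (`S ≥ 1`), every `β ≥ 4`, every orientation class `o` and every
  profile `0 ≤ a ≤ ½` — the exponent is linear in the TOTAL tilt `∑ₓ a(x)`, uniformly in the volume.
  The sibling `localExpMoment_class` (p249031) is the indicator case `a = a·1_Q`.

Proof: the tree's four-direction tilt chessboard (`…SparseDefectOrbitWindow.tiltChessboard`) with the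
profile `c = β·a`, the full-class bound `integral_exp_class_le_exp` (convexity of `log Z` + uniform
torus doubling `uniformDoubling_all`) for each factor, and cancellation of the `L⁴`-th powers.
Everything is proved (kernel; no hypothesis, no `def`).

HONEST FRAMING: rung 0 of (LS) only (bare measure); (LS) at scales `j ≥ 1` untouched; NE7b
(`T4WeightBudget.RelWeightBound`) NOT PRINTED in [Bałaban 1983–89] and NOT PROVED; spine PROVED 0∕9; rung
(B)+1 on a FINITE torus T⁴ — NOT infinite volume, NOT the mass gap, NOT Clay. HONEST DEPENDENCY: continuum
YM on T⁴ ⇐ BetaPertH ∧ nine spine estimates (0/9 proved); BetaPertH ⇐ (D1) ∧ (D4) ∧ CAP+tail; G-an2-4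
gates asym, D1 and NE2/3/4.
-/

set_option autoImplicit false

noncomputable section

namespace Summit.QuantumFields.BalabanUV.T4Continuum.NE7b.LocalPlaquetteExpMoments

open scoped BigOperators
open MeasureTheory
open Literature.MathematicalPhysics.QuantumFieldTheory
open Summit.QuantumFields.YangMills.Cruxes.LatticeGapOnTrajectory.SparseDefectOrbitWindow (tiltChessboard)
open Summit.QuantumFields.YangMills.Theorems.FemtoCurvatureTwoPoint.PlaquetteVariance (card_site)

variable {G : Type} [Group G] [TopologicalSpace G] [IsTopologicalGroup G] [CompactSpace G]
  [MeasurableSpace G] [BorelSpace G]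

section Profile

/-- **LOCAL EXPONENTIAL PLAQUETTE MOMENTS WITH A TILT PROFILE ((LS) at `j = 0`, multiplicative form).**
For a faithful continuous unitary lattice representation `r` of a compact group `G` there is `C ≥ 0`
such that for every odd torus `(ℤ/(2S+1))⁴` with `S ≥ 1`, every `β ≥ 4`, every orientation class `o`
and every profile `a` on the sites with `0 ≤ a(x) ≤ ½`:
`∫ exp(β·∑ₓ a(x)·(N − Re tr r(U_{(x,o)}))) dμ_β ≤ exp(C·∑ₓ a(x))`. -/
theorem localExpMoment_profile (r : LatticeRep G) :
    ∃ C : ℝ, 0 ≤ C ∧ ∀ (S : ℕ), 1 ≤ S → ∀ (β : ℝ), 4 ≤ β → ∀ (o : {q : Fin 4 × Fin 4 // q.1 < q.2})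
      (a : Site 4 (2 * S + 1) → ℝ), (∀ x, 0 ≤ a x) → (∀ x, a x ≤ 1 / 2) →
        ∫ U, Real.exp (β * ∑ x : Site 4 (2 * S + 1), a x * ((r.N : ℝ) - WilsonRP.plaqRe r.ρ U (x, o)))
            ∂(wilsonMeasure r.ρ β : Measure (GaugeConfig 4 (2 * S + 1) G)) ≤
          Real.exp (C * ∑ x : Site 4 (2 * S + 1), a x) := by
  obtain ⟨A, hA0, hA⟩ := exists_log_doubling r
  refine ⟨2 * A, by positivity, fun S hS β hβ o a ha0 ha => ?_⟩
  haveI hprob := isProbabilityMeasure_wilsonMeasure (d := 4) (L := 2 * S + 1) (G := G) r.ρ r.continuous β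
  have hT2 : 2 ≤ 2 * S + 1 := by omega
  have hβ0 : 0 ≤ β := by linarith
  -- the tilt profile `β · a` and the chessboard estimate for it
  let c : Site 4 (2 * S + 1) → ℝ := fun x => a x * β
  have hc0 : ∀ x, 0 ≤ c x := fun x => mul_nonneg (ha0 x) hβ0
  have hcβ : ∀ x, c x ≤ β := fun x => by
    have := ha x
    show a x * β ≤ β
    nlinarith
  have hchess := tiltChessboard S r.N G r.ρ hS r.continuous β hβ0 o c hc0 hcβ
  -- notation
  set μ : Measure (GaugeConfig 4 (2 * S + 1) G) := wilsonMeasure r.ρ β with hμ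
  set E : GaugeConfig 4 (2 * S + 1) G → ℝ :=
    fun U => ∑ x : Site 4 (2 * S + 1), a x * ((r.N : ℝ) - WilsonRP.plaqRe r.ρ U (x, o)) with hE
  set F : GaugeConfig 4 (2 * S + 1) G → ℝ :=
    fun U => ∑ x : Site 4 (2 * S + 1), ((r.N : ℝ) - WilsonRP.plaqRe r.ρ U (x, o)) with hF
  set σ : ℝ := ∑ x : Site 4 (2 * S + 1), a x with hσ
  change ∫ U, Real.exp (β * E U) ∂μ ≤ Real.exp (2 * A * σ)
  set I : ℝ := ∫ U, Real.exp (β * E U) ∂μ with hI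
  have hI0 : 0 ≤ I := integral_nonneg fun U => (Real.exp_pos _).le
  -- LHS integrand: `exp(−∑ c·Re tr) = exp(−βNσ) · exp(β E)`
  have hLHS : ∀ U : GaugeConfig 4 (2 * S + 1) G,
      Real.exp (-∑ x : Site 4 (2 * S + 1), c x * WilsonRP.plaqRe r.ρ U (x, o)) =
        Real.exp (-(β * r.N * σ)) * Real.exp (β * E U) := by
    intro U
    rw [← Real.exp_add]
    congr 1
    have hE' : E U = σ * (r.N : ℝ) - ∑ x : Site 4 (2 * S + 1), a x * WilsonRP.plaqRe r.ρ U (x, o) := by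
      simp only [hE, hσ, mul_sub, Finset.sum_sub_distrib, Finset.sum_mul]
    have hc' : ∑ x : Site 4 (2 * S + 1), c x * WilsonRP.plaqRe r.ρ U (x, o) =
        β * ∑ x : Site 4 (2 * S + 1), a x * WilsonRP.plaqRe r.ρ U (x, o) := by
      rw [Finset.mul_sum]
      refine Finset.sum_congr rfl fun x _ => ?_
      show a x * β * _ = _
      ring
    rw [hc', hE']
    ring
  have hLHSint : ∫ U, Real.exp (-∑ x : Site 4 (2 * S + 1), c x * WilsonRP.plaqRe r.ρ U (x, o)) ∂μ =
      Real.exp (-(β * r.N * σ)) * I := by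
    simp_rw [hLHS]
    rw [integral_const_mul]
  -- RHS factor at `y`: the full-class moment with parameter `a y`
  have hfull : ∀ (y : Site 4 (2 * S + 1)) (U : GaugeConfig 4 (2 * S + 1) G),
      Real.exp (-∑ x : Site 4 (2 * S + 1), c y * WilsonRP.plaqRe r.ρ U (x, o)) =
        Real.exp (-(a y * β * r.N * ((2 * S + 1 : ℕ) : ℝ) ^ 4)) * Real.exp (a y * β * F U) := by
    intro y U
    rw [← Real.exp_add]
    congr 1
    have hsum : ∑ x : Site 4 (2 * S + 1), c y * WilsonRP.plaqRe r.ρ U (x, o) =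
        a y * β * ∑ x : Site 4 (2 * S + 1), WilsonRP.plaqRe r.ρ U (x, o) := by rw [← Finset.mul_sum]
    have hF' : F U = (r.N : ℝ) * ((2 * S + 1 : ℕ) : ℝ) ^ 4 -
        ∑ x : Site 4 (2 * S + 1), WilsonRP.plaqRe r.ρ U (x, o) := by
      simp only [hF, Finset.sum_sub_distrib, Finset.sum_const, Finset.card_univ, card_site, nsmul_eq_mul,
        Nat.cast_pow]; ring
    rw [hsum, hF']
    ring
  have hRHS : ∀ y : Site 4 (2 * S + 1),
      ∫ U, Real.exp (-∑ x : Site 4 (2 * S + 1), c y * WilsonRP.plaqRe r.ρ U (x, o)) ∂μ ≤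
        Real.exp (-(a y * β * r.N * ((2 * S + 1 : ℕ) : ℝ) ^ 4)) *
          Real.exp (2 * a y * A * ((2 * S + 1 : ℕ) : ℝ) ^ 4) := by
    intro y
    simp_rw [hfull y]
    rw [integral_const_mul]
    exact mul_le_mul_of_nonneg_left (integral_exp_class_le_exp r hA hT2 hβ (ha0 y) (ha y) o)
      (Real.exp_pos _).le
  have hRHS0 : ∀ y : Site 4 (2 * S + 1),
      0 ≤ ∫ U, Real.exp (-∑ x : Site 4 (2 * S + 1), c y * WilsonRP.plaqRe r.ρ U (x, o)) ∂μ :=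
    fun y => integral_nonneg fun U => (Real.exp_pos _).le
  have hprod : ∏ y : Site 4 (2 * S + 1),
        ∫ U, Real.exp (-∑ x : Site 4 (2 * S + 1), c y * WilsonRP.plaqRe r.ρ U (x, o)) ∂μ ≤
      ∏ y : Site 4 (2 * S + 1), (Real.exp (-(a y * β * r.N * ((2 * S + 1 : ℕ) : ℝ) ^ 4)) *
          Real.exp (2 * a y * A * ((2 * S + 1 : ℕ) : ℝ) ^ 4)) :=
    Finset.prod_le_prod (fun y _ => hRHS0 y) fun y _ => hRHS y
  -- the product of the factors is `(e^{−βNσ} · e^{2Aσ})^{L⁴}`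
  have hprod_eq : ∏ y : Site 4 (2 * S + 1), (Real.exp (-(a y * β * r.N * ((2 * S + 1 : ℕ) : ℝ) ^ 4)) *
          Real.exp (2 * a y * A * ((2 * S + 1 : ℕ) : ℝ) ^ 4)) =
      (Real.exp (-(β * r.N * σ)) * Real.exp (2 * A * σ)) ^ ((2 * S + 1) ^ 4) := by
    rw [Finset.prod_congr rfl fun (y : Site 4 (2 * S + 1)) (_ : y ∈ Finset.univ) =>
        (Real.exp_add (-(a y * β * r.N * ((2 * S + 1 : ℕ) : ℝ) ^ 4))
          (2 * a y * A * ((2 * S + 1 : ℕ) : ℝ) ^ 4)).symm,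
      ← Real.exp_sum, ← Real.exp_add, ← Real.exp_nat_mul]
    congr 1
    calc ∑ y : Site 4 (2 * S + 1), (-(a y * β * r.N * ((2 * S + 1 : ℕ) : ℝ) ^ 4) +
            2 * a y * A * ((2 * S + 1 : ℕ) : ℝ) ^ 4)
        = ∑ y : Site 4 (2 * S + 1), (-(β * r.N) + 2 * A) * ((2 * S + 1 : ℕ) : ℝ) ^ 4 * a y :=
          Finset.sum_congr rfl fun y _ => by ring
      _ = (-(β * r.N) + 2 * A) * ((2 * S + 1 : ℕ) : ℝ) ^ 4 * σ := by rw [hσ, Finset.mul_sum]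
      _ = (((2 * S + 1) ^ 4 : ℕ) : ℝ) * (-(β * r.N * σ) + 2 * A * σ) := by push_cast; ring
  -- combine and cancel
  have hmain : (Real.exp (-(β * r.N * σ)) * I) ^ ((2 * S + 1) ^ 4) ≤
      (Real.exp (-(β * r.N * σ)) * Real.exp (2 * A * σ)) ^ ((2 * S + 1) ^ 4) := by
    have h := hchess.trans hprod
    rw [hLHSint, hprod_eq] at h
    exact h
  have hT0 : (2 * S + 1) ^ 4 ≠ 0 := pow_ne_zero _ (by omega)
  have hcancel := (pow_le_pow_iff_left₀ (mul_nonneg (Real.exp_pos _).le hI0)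
    (mul_nonneg (Real.exp_pos _).le (Real.exp_pos _).le) hT0).1 hmain
  exact le_of_mul_le_mul_left hcancel (Real.exp_pos _)

end Profile

/-! ## v1.1 (APPEND-ONLY): the bounds for ALL `β ≥ 0`

For `β ≤ 4` every statement above is trivial since `0 ≤ N − Re tr r(U_p) ≤ 2N`; the corollaries below merge the two
regimes into ONE constant, so that consumers need no threshold in `β` (the volume side stays: odd tori `(2S+1)⁴`,
`S ≥ 1`). -/

section AllBeta

/-- The integral of `exp ∘ g` against the Wilson (probability) measure is at most `exp B` when `g ≤ B` pointwise
(and `g` is measurable and bounded in absolute value). -/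
theorem integral_exp_le_exp_of_le {N L : ℕ} [NeZero L] (ρ : G →* Matrix (Fin N) (Fin N) ℂ) (hρ : Continuous ρ)
    (β : ℝ) {g : GaugeConfig 4 L G → ℝ} (hg : Measurable g) {B : ℝ} (habs : ∀ U, |g U| ≤ B)
    (hle : ∀ U, g U ≤ B) :
    ∫ U, Real.exp (g U) ∂(wilsonMeasure (d := 4) (L := L) ρ β) ≤ Real.exp B := by
  haveI := isProbabilityMeasure_wilsonMeasure (d := 4) (L := L) (G := G) ρ hρ β
  calc ∫ U, Real.exp (g U) ∂(wilsonMeasure (d := 4) (L := L) ρ β)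
      ≤ ∫ _U, Real.exp B ∂(wilsonMeasure (d := 4) (L := L) ρ β) :=
        integral_mono (integrable_exp_of_abs_le ρ hρ β hg habs) (integrable_const _)
          fun U => Real.exp_le_exp.2 (hle U)
    _ = Real.exp B := by rw [integral_const, probReal_univ, one_smul]

/-- **Local exponential plaquette moments, one class, ALL `β ≥ 0`.** `∃ C ≥ 0, ∀ S ≥ 1, ∀ β ≥ 0, ∀ 0 ≤ a ≤ ½,
∀ o, ∀ Q: ∫ exp(aβ ∑_{x∈Q}(N − Re tr r(U_{(x,o)}))) dμ_β ≤ exp(C a #Q)` (for `β ≥ 4` this is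
`localExpMoment_class`; for `β ≤ 4` the exponent is at most `8N·a·#Q` pointwise). -/
theorem localExpMoment_class_allBeta (r : LatticeRep G) :
    ∃ C : ℝ, 0 ≤ C ∧ ∀ (S : ℕ), 1 ≤ S → ∀ (β : ℝ), 0 ≤ β → ∀ (a : ℝ), 0 ≤ a → a ≤ 1 / 2 →
      ∀ (o : {q : Fin 4 × Fin 4 // q.1 < q.2}) (Q : Finset (Site 4 (2 * S + 1))),
        ∫ U, Real.exp (a * β * ∑ x ∈ Q, ((r.N : ℝ) - WilsonRP.plaqRe r.ρ U (x, o)))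
            ∂(wilsonMeasure r.ρ β : Measure (GaugeConfig 4 (2 * S + 1) G)) ≤
          Real.exp (C * a * Q.card) := by
  obtain ⟨C, hC0, hC⟩ := localExpMoment_class r
  refine ⟨max C (8 * r.N), le_max_of_le_left hC0, fun S hS β hβ0 a ha0 ha o Q => ?_⟩
  rcases le_or_gt 4 β with hβ | hβ
  · refine (hC S hS β hβ a ha0 ha o Q).trans (Real.exp_le_exp.2 ?_)
    exact mul_le_mul_of_nonneg_right (mul_le_mul_of_nonneg_right (le_max_left _ _) ha0) (Nat.cast_nonneg _)
  · have hab : 0 ≤ a * β := mul_nonneg ha0 hβ0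
    have habs := fun U : GaugeConfig 4 (2 * S + 1) G => abs_sum_plaqEnergy_le r.ρ r.continuous o Q U
    refine (integral_exp_le_exp_of_le r.ρ r.continuous β
      (measurable_mul_sum_plaqEnergy r.ρ r.continuous (a * β) o Q) (B := a * β * (2 * r.N * Q.card))
      (fun U => ?_) (fun U => ?_)).trans (Real.exp_le_exp.2 ?_)
    · rw [abs_mul, abs_of_nonneg hab]
      exact mul_le_mul_of_nonneg_left (habs U) hab
    · exact mul_le_mul_of_nonneg_left ((le_abs_self _).trans (habs U)) hab
    · have h1 : a * β * (2 * r.N * Q.card) ≤ a * 4 * (2 * r.N * Q.card) :=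
        mul_le_mul_of_nonneg_right (mul_le_mul_of_nonneg_left hβ.le ha0) (by positivity)
      have h2 : (8 * (r.N : ℝ)) * a * Q.card ≤ max C (8 * r.N) * a * Q.card :=
        mul_le_mul_of_nonneg_right (mul_le_mul_of_nonneg_right (le_max_right _ _) ha0) (Nat.cast_nonneg _)
      linarith

/-- **Local exponential plaquette moments with a tilt profile, ALL `β ≥ 0`.** `∃ C ≥ 0, ∀ S ≥ 1, ∀ β ≥ 0, ∀ o,
∀ profile 0 ≤ a ≤ ½: ∫ exp(β ∑ₓ a(x)(N − Re tr r(U_{(x,o)}))) dμ_β ≤ exp(C ∑ₓ a(x))`. -/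
theorem localExpMoment_profile_allBeta (r : LatticeRep G) :
    ∃ C : ℝ, 0 ≤ C ∧ ∀ (S : ℕ), 1 ≤ S → ∀ (β : ℝ), 0 ≤ β → ∀ (o : {q : Fin 4 × Fin 4 // q.1 < q.2})
      (a : Site 4 (2 * S + 1) → ℝ), (∀ x, 0 ≤ a x) → (∀ x, a x ≤ 1 / 2) →
        ∫ U, Real.exp (β * ∑ x : Site 4 (2 * S + 1), a x * ((r.N : ℝ) - WilsonRP.plaqRe r.ρ U (x, o)))
            ∂(wilsonMeasure r.ρ β : Measure (GaugeConfig 4 (2 * S + 1) G)) ≤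
          Real.exp (C * ∑ x : Site 4 (2 * S + 1), a x) := by
  obtain ⟨C, hC0, hC⟩ := localExpMoment_profile r
  refine ⟨max C (8 * r.N), le_max_of_le_left hC0, fun S hS β hβ0 o a ha0 ha => ?_⟩
  have hσ0 : 0 ≤ ∑ x : Site 4 (2 * S + 1), a x := Finset.sum_nonneg fun x _ => ha0 x
  rcases le_or_gt 4 β with hβ | hβ
  · exact (hC S hS β hβ o a ha0 ha).trans (Real.exp_le_exp.2 (mul_le_mul_of_nonneg_right (le_max_left _ _) hσ0))
  · -- pointwise: `0 ≤ ∑ a(x) A_x ≤ 2N ∑ a(x)`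
    have hpt : ∀ U : GaugeConfig 4 (2 * S + 1) G,
        0 ≤ ∑ x : Site 4 (2 * S + 1), a x * ((r.N : ℝ) - WilsonRP.plaqRe r.ρ U (x, o)) ∧
          ∑ x : Site 4 (2 * S + 1), a x * ((r.N : ℝ) - WilsonRP.plaqRe r.ρ U (x, o)) ≤
            2 * r.N * ∑ x : Site 4 (2 * S + 1), a x := by
      intro U
      refine ⟨Finset.sum_nonneg fun x _ => mul_nonneg (ha0 x) (plaqEnergy_nonneg r.ρ r.continuous U (x, o)), ?_⟩
      rw [Finset.mul_sum]
      refine Finset.sum_le_sum fun x _ => ?_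
      have := mul_le_mul_of_nonneg_left (plaqEnergy_le r.ρ r.continuous U (x, o)) (ha0 x)
      linarith
    have hmeas : Measurable fun U : GaugeConfig 4 (2 * S + 1) G =>
        β * ∑ x : Site 4 (2 * S + 1), a x * ((r.N : ℝ) - WilsonRP.plaqRe r.ρ U (x, o)) :=
      (Finset.measurable_sum _ fun x _ =>
        (measurable_const.sub (WilsonRP.measurable_plaqRe r.ρ r.continuous (x, o))).const_mul (a x)).const_mul β
    refine (integral_exp_le_exp_of_le r.ρ r.continuous β hmeas
      (B := β * (2 * r.N * ∑ x : Site 4 (2 * S + 1), a x)) (fun U => ?_) (fun U => ?_)).trans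
      (Real.exp_le_exp.2 ?_)
    · rw [abs_mul, abs_of_nonneg hβ0, abs_of_nonneg (hpt U).1]
      exact mul_le_mul_of_nonneg_left (hpt U).2 hβ0
    · exact mul_le_mul_of_nonneg_left (hpt U).2 hβ0
    · have h1 : β * (2 * r.N * ∑ x : Site 4 (2 * S + 1), a x) ≤ 4 * (2 * r.N * ∑ x : Site 4 (2 * S + 1), a x) :=
        mul_le_mul_of_nonneg_right hβ.le (by positivity)
      have h2 : (8 * (r.N : ℝ)) * ∑ x : Site 4 (2 * S + 1), a x ≤ max C (8 * r.N) * ∑ x : Site 4 (2 * S + 1), a x :=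
        mul_le_mul_of_nonneg_right (le_max_right _ _) hσ0
      linarith

/-- **The mean plaquette energy is `O(1/β)` for ALL `β > 0`, uniformly in the (odd) volume**:
`∃ C' ≥ 0, ∀ S ≥ 1, ∀ β > 0, ∀ p: ∫ (N − Re tr r(U_p)) dμ_β ≤ C'/β` (for `β ≤ 4` use `N − Re tr ≤ 2N ≤ 8N/β`). -/
theorem integral_plaqEnergy_le_div_allBeta (r : LatticeRep G) :
    ∃ C' : ℝ, 0 ≤ C' ∧ ∀ (S : ℕ), 1 ≤ S → ∀ (β : ℝ), 0 < β → ∀ (p : Plaquette 4 (2 * S + 1)),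
      ∫ U, ((r.N : ℝ) - WilsonRP.plaqRe r.ρ U p)
          ∂(wilsonMeasure r.ρ β : Measure (GaugeConfig 4 (2 * S + 1) G)) ≤ C' / β := by
  obtain ⟨C', hC0, hC⟩ := integral_plaqEnergy_le_div r
  refine ⟨max C' (8 * r.N), le_max_of_le_left hC0, fun S hS β hβ p => ?_⟩
  haveI := isProbabilityMeasure_wilsonMeasure (d := 4) (L := 2 * S + 1) (G := G) r.ρ r.continuous β
  rcases le_or_gt 4 β with hβ4 | hβ4
  · exact (hC S hS β hβ4 p).trans (div_le_div_of_nonneg_right (le_max_left _ _) hβ.le)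
  · have hle : ∫ U, ((r.N : ℝ) - WilsonRP.plaqRe r.ρ U p)
        ∂(wilsonMeasure r.ρ β : Measure (GaugeConfig 4 (2 * S + 1) G)) ≤ 2 * r.N := by
      calc ∫ U, ((r.N : ℝ) - WilsonRP.plaqRe r.ρ U p) ∂(wilsonMeasure r.ρ β : Measure (GaugeConfig 4 (2 * S + 1) G))
          ≤ ∫ _U, (2 * (r.N : ℝ)) ∂(wilsonMeasure r.ρ β : Measure (GaugeConfig 4 (2 * S + 1) G)) := by
            refine integral_mono_of_nonneg (ae_of_all _ fun U => plaqEnergy_nonneg r.ρ r.continuous U p)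
              (integrable_const _) (ae_of_all _ fun U => plaqEnergy_le r.ρ r.continuous U p)
        _ = 2 * r.N := by rw [integral_const, probReal_univ, one_smul]
    rw [le_div_iff₀ hβ]
    have hN : (0 : ℝ) ≤ r.N := Nat.cast_nonneg _
    have h1 : (∫ U, ((r.N : ℝ) - WilsonRP.plaqRe r.ρ U p)
        ∂(wilsonMeasure r.ρ β : Measure (GaugeConfig 4 (2 * S + 1) G))) * β ≤ 2 * r.N * 4 :=
      mul_le_mul hle hβ4.le hβ.le (by positivity)
    linarith [le_max_right C' (8 * (r.N : ℝ))]

end AllBeta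

end Summit.QuantumFields.BalabanUV.T4Continuum.NE7b.LocalPlaquetteExpMoments

end
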